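import Summits.HubbardSuperconductivity.HubbardSuperconductivity.Theorems.AnisotropyChordTransferMonotoneN
import Summits.HubbardSuperconductivity.HubbardSuperconductivity.Theorems.AnisotropyChordTransferFerroGapCorollaries
import Summits.HubbardSuperconductivity.HubbardSuperconductivity.Theorems.AnisotropyChordTransferFerroGapSharp
import Summits.HubbardSuperconductivity.HubbardSuperconductivity.Theorems.AnisotropyChordTowerParticleHole
import Summits.HubbardSuperconductivity.HubbardSuperconductivity.Theorems.AnisotropyChordTransferSectors
import Summits.HubbardSuperconductivity.HubbardSuperconductivity.Theorems.AnisotropyChordTransferFlipExcess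

/-!
# Route `AnisotropyChord` / H0 rotor rung, route (1): CONJECTURE MON-n FEEDS THE TRANSFER CHAIN

PART N26 (`…TransferMonotoneN`, theory seat `hubbard-h0-rotor-theory-1`, cycle 20, memo ROTOR-THEORY-20 §264) typed
CONJECTURE MON-n (`SectorGapMonotoneInN Δ`: the Temple-form sector gap of `H(Δ)` is monotone in the particle number up to
half filling) and stated in prose that «together with `γ(1 − V/2) = ε₁` (one-magnon sector, exact) and particle–hole symmetry
`M ↔ −M` it gives END_n (`γ(M) ≥ ε₁`) in every sector, hence — via the cycle-12…19 transfer chain — the H0 · PC rotor rung».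
This file makes that sentence a theorem of the tree:

* `oneMagnon_sectorGap` : the one-magnon input `SectorGapAtLeast L Δ (1 − V/2) (1 − cos 2π/L)` for every `Δ ≤ 1`, `L ≥ 3`
  (THEOREM near-END, `nearEnd_uniform_holds`, whose tangent correction `(1−Δ)·2n(n−1)/(V−1)` vanishes at `n = 1`);
* `sectorGapAtLeast_neg` : particle–hole symmetry of the Temple-form gap statement, `SectorGapAtLeast L Δ M g →
  SectorGapAtLeast L Δ (−M) g` (flip of Perron amplitudes `…Tower.isPerron_flipAll`, `energyQ_comp_flipAll`);
* `end_of_monotoneInN` : MON-n(Δ) ⇒ END in every sector `1 − V/2 + k ≤ 0`;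
* **`gapDominatesFerro_of_monotoneInN`** : MON-n(Δ) for all `Δ ∈ [Δ₀, 1]` ⇒ `GapDominatesFerro Δ₀ k` for EVERY `k`
  (CONJECTURE GM, endpoint form, on the sectors `|j| ≤ k`; the step `g ≤ ε₁` at `Δ = 1` is the sharpness theorem
  `sectorGapAtLeast_one_le`; empty sectors — odd `L` — are vacuous);
* **`condensateOnFirstSectors_of_monotoneInN`** : MON-n on `[Δ, 1]` + the half-filling anchor + the chain threshold ⇒
  `CondensateOnFirstSectors Δ k` (BEC on the first `k` sectors), by `condensateOnFirstSectors_of_gapDominatesFerro'`.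

So after this file the hypotheses of the BEC-near-half-filling chain read: ANCHOR + MON-n (or ANCHOR + GM).
Prover seat `hubbard-h0-rotor-p1` g21; helper for stmt-HubbardSuperconductivity-19089 (`--supports`).  No definition is
introduced; nothing here is a statement about the Hubbard model.
-/

set_option linter.dupNamespace false
set_option autoImplicit false

noncomputable section

open Finset Filter Topology
open Literature.MathematicalPhysics.QuantumLattice Literature.Probability.LatticeModels
open Summit.HubbardSuperconductivity.HubbardSuperconductivity.Theorems.AnisotropyChord.InsertionEntropy
open Summit.HubbardSuperconductivity.HubbardSuperconductivity.Theorems.AnisotropyChord.Tower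
open Summit.HubbardSuperconductivity.HubbardSuperconductivity.Theorems.AnisotropyChord

namespace Summit.HubbardSuperconductivity.HubbardSuperconductivity.Theorems.AnisotropyChord.Transfer

variable {L : ℕ} [NeZero L]

/-! ## The one-magnon input -/

/-- **END in the one-magnon sector, every `Δ ≤ 1`:** `SectorGapAtLeast L Δ (1 − V/2) (1 − cos(2π/L))` for `L ≥ 3`
(THEOREM near-END with `n = V/2 + M = 1`, where the tangent correction `(1−Δ)·2n(n−1)/(V−1)` vanishes).
[cite: CaputoLiggettRichthammer2010, Theorem 1.1] -/
theorem oneMagnon_sectorGap (hL : 3 ≤ L) {Δ : ℝ} (hΔ : Δ ≤ 1) :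
    SectorGapAtLeast L Δ (1 - (Fintype.card (TorusSite 2 L) : ℝ) / 2) (1 - Real.cos (2 * Real.pi / (L : ℝ))) := by
  have h := nearEnd_uniform_holds hL hΔ (1 - (Fintype.card (TorusSite 2 L) : ℝ) / 2)
  refine sectorGapAtLeast_mono (le_of_eq ?_) h
  ring

/-! ## Particle–hole symmetry of the Temple-form gap statement -/

/-- every element of `Fin 2` is `0` or `1`. [folklore] -/
private theorem fin2_cases_chain (i : Fin 2) : i = 0 ∨ i = 1 := by
  rcases i with ⟨_ | _ | k, hk⟩
  · left; rfl
  · right; rfl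
  · omega

/-- support of a real amplitude of the sector `Sᶻ_tot = M`: `φ σ ≠ 0 ⇒ zerosCard σ = V/2 + M`. [folklore] -/
theorem support_of_mem_sector {M : ℝ} {φ : TensorIndex (TorusSite 2 L) 2 → ℝ}
    (hφ : cplx L φ ∈ spinZSector (Λ := TorusSite 2 L) 1 M) (σ : TensorIndex (TorusSite 2 L) 2) (hσ : φ σ ≠ 0) :
    zerosCard σ = (Fintype.card (TorusSite 2 L) : ℝ) / 2 + M := by
  have h := (LiebMattis.mem_spinZSector_iff (Λ := TorusSite 2 L) 1 M (cplx L φ)).1 hφ σ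
    (by unfold cplx; exact_mod_cast hσ)
  have hre : (∑ x : TorusSite 2 L, ((1 : ℝ) / 2 - (σ x : ℕ))) = M := by
    have h' : (((∑ x : TorusSite 2 L, ((1 : ℝ) / 2 - (σ x : ℕ)) : ℝ)) : ℂ) = (M : ℂ) := by
      push_cast at h ⊢; exact h
    exact_mod_cast h'
  have hsplit : (∑ x : TorusSite 2 L, ((1 : ℝ) / 2 - (σ x : ℕ)))
      = (Fintype.card (TorusSite 2 L) : ℝ) / 2 - ∑ x : TorusSite 2 L, ((σ x : ℕ) : ℝ) := by
    rw [Finset.sum_sub_distrib, Finset.sum_const, Finset.card_univ, nsmul_eq_mul]; ring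
  have hones : (∑ x : TorusSite 2 L, ((σ x : ℕ) : ℝ)) = (Fintype.card (TorusSite 2 L) : ℝ) - zerosCard σ := by
    have h1 : ∀ x : TorusSite 2 L, ((σ x : ℕ) : ℝ) = 1 - (if σ x = 0 then (1:ℝ) else 0) := by
      intro x; rcases fin2_cases_chain (σ x) with hx | hx <;> simp [hx]
    simp_rw [h1]
    rw [Finset.sum_sub_distrib, Finset.sum_const, Finset.card_univ, nsmul_eq_mul, mul_one]
    unfold zerosCard; rw [← Finset.sum_filter]; simp
  rw [hsplit, hones] at hre
  linarith

/-- the global spin flip maps the sector `M` to the sector `−M` (real amplitudes). [folklore] -/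
theorem mem_sector_flipAll {M : ℝ} {φ : TensorIndex (TorusSite 2 L) 2 → ℝ}
    (hφ : cplx L φ ∈ spinZSector (Λ := TorusSite 2 L) 1 M) :
    cplx L (φ ∘ flipAll) ∈ spinZSector (Λ := TorusSite 2 L) 1 (-M) := by
  have h := mem_spinZSector_of_support (L := L) (-M) (φ ∘ flipAll) (by
    intro σ hσ
    have h := support_of_mem_sector hφ (flipAll σ) hσ
    rw [zerosCard_flipAll] at h
    linarith)
  exact h

/-- `E(−M) = E(M)` when both sectors carry Perron amplitudes. [folklore] -/
theorem sectorE_neg_eq {Δ M : ℝ} {a b : TensorIndex (TorusSite 2 L) 2 → ℝ}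
    (ha : IsPerronSectorGroundAmplitude L Δ M a) (hb : IsPerronSectorGroundAmplitude L Δ (-M) b) :
    sectorE L Δ (-M) = sectorE L Δ M := by
  rw [sectorE_eq, sectorE_eq]
  refine le_antisymm (lowestEnergy_neg_le ha) ?_
  have := lowestEnergy_neg_le hb
  rwa [neg_neg] at this

/-- a sector without Perron amplitude satisfies every Temple-form gap statement vacuously. [folklore] -/
theorem sectorGapAtLeast_of_no_perron {Δ M g : ℝ}
    (h : ∀ a : TensorIndex (TorusSite 2 L) 2 → ℝ, ¬ IsPerronSectorGroundAmplitude L Δ M a) :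
    SectorGapAtLeast L Δ M g :=
  fun a _ ha _ _ => (h a ha).elim

/-- **Particle–hole symmetry of the sector gap (Temple form):** `SectorGapAtLeast L Δ M g → SectorGapAtLeast L Δ (−M) g`.
[folklore] -/
theorem sectorGapAtLeast_neg {Δ M g : ℝ} (h : SectorGapAtLeast L Δ M g) : SectorGapAtLeast L Δ (-M) g := by
  classical
  by_cases hex : ∃ b : TensorIndex (TorusSite 2 L) 2 → ℝ, IsPerronSectorGroundAmplitude L Δ M b
  · intro a φ ha hφ hunit
    obtain ⟨b, hb⟩ := hex
    have hb' : IsPerronSectorGroundAmplitude L Δ (-(-M)) b := by rw [neg_neg]; exact hb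
    have haf : IsPerronSectorGroundAmplitude L Δ M (a ∘ flipAll) := by
      have := isPerron_flipAll ha hb'; rwa [neg_neg] at this
    have hφf : cplx L (φ ∘ flipAll) ∈ spinZSector (Λ := TorusSite 2 L) 1 M := by
      have := mem_sector_flipAll hφ; rwa [neg_neg] at this
    have hunitf : ∑ σ, (φ ∘ flipAll) σ ^ 2 = 1 := by
      simp only [Function.comp_apply]
      rw [sum_flipAll (fun τ => φ τ ^ 2)]; exact hunit
    have key := h (a ∘ flipAll) (φ ∘ flipAll) haf hφf hunitf
    have e1 : ∑ σ, (a ∘ flipAll) σ * (φ ∘ flipAll) σ = ∑ σ, a σ * φ σ := by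
      simp only [Function.comp_apply]
      exact sum_flipAll (fun τ => a τ * φ τ)
    rw [e1, energyQ_comp_flipAll, ← sectorE_neg_eq haf (by rw [neg_neg] at hb'; exact ha)] at key
    exact key
  · -- no Perron amplitude in the sector `M` ⇒ none in `−M` either (flip), so the statement is vacuous
    apply sectorGapAtLeast_of_no_perron
    intro a ha
    apply hex
    refine ⟨a ∘ flipAll, ?_⟩
    -- a Perron amplitude of `−M` flips to one of `M = −(−M)` provided the sector `M` has one — circular; instead
    -- construct one in the sector `M` directly from the weight bookkeeping of `a`
    exfalso
    obtain ⟨n, hnV, hn⟩ := perron_natSector ha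
    have hW : n ≤ L ^ 2 := by
      have : Fintype.card (TorusSite 2 L) = L ^ 2 := by rw [Fintype.card_fun, ZMod.card, Fintype.card_fin]
      omega
    obtain ⟨b, hb⟩ := exists_perron_of_weight (L := L) Δ n hW
    apply hex
    refine ⟨b, ?_⟩
    have e : ((Fintype.card (TorusSite 2 L) * 1 : ℕ) : ℝ) / 2 - (n : ℝ) = M := by
      push_cast; linarith
    rw [e] at hb
    exact hb

/-! ## MON-n ⇒ END in every sector up to half filling -/

/-- MON-n(Δ) ⇒ `SectorGapAtLeast L Δ (1 − V/2 + k) (1 − cos 2π/L)` for every `k` with `1 − V/2 + k ≤ 0` (`Δ ≤ 1`, `L ≥ 3`).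
[cite: CaputoLiggettRichthammer2010, Theorem 1.1] -/
theorem end_of_monotoneInN {Δ : ℝ} (hmon : SectorGapMonotoneInN Δ) (hL : 3 ≤ L) (hΔ : Δ ≤ 1) (k : ℕ)
    (hk : 1 - (Fintype.card (TorusSite 2 L) : ℝ) / 2 + k ≤ 0) :
    SectorGapAtLeast L Δ (1 - (Fintype.card (TorusSite 2 L) : ℝ) / 2 + k) (1 - Real.cos (2 * Real.pi / (L : ℝ))) :=
  sectorGapAtLeast_of_monotone hmon L (by omega) _ (oneMagnon_sectorGap hL hΔ) k hk

/-- MON-n(Δ) ⇒ END in the integer sector `j ≤ 0` whenever it is non-empty (`V/2 + j = n ≥ 1` an integer). [folklore] -/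
theorem end_int_of_monotoneInN {Δ : ℝ} (hmon : SectorGapMonotoneInN Δ) (hL : 3 ≤ L) (hΔ : Δ ≤ 1) (j : ℤ)
    (hj : j ≤ 0) (n : ℕ) (hn1 : 1 ≤ n) (hn : (n : ℝ) = (Fintype.card (TorusSite 2 L) : ℝ) / 2 + j) :
    SectorGapAtLeast L Δ (j : ℝ) (1 - Real.cos (2 * Real.pi / (L : ℝ))) := by
  have hj' : ((j : ℤ) : ℝ) ≤ 0 := by exact_mod_cast hj
  have e : (1 - (Fintype.card (TorusSite 2 L) : ℝ) / 2 + ((n - 1 : ℕ) : ℝ)) = (j : ℝ) := by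
    rw [Nat.cast_sub hn1]; push_cast; linarith
  have h := end_of_monotoneInN hmon hL hΔ (n - 1) (by rw [e]; exact hj')
  rw [e] at h
  exact h

/-! ## MON-n ⇒ CONJECTURE GM (endpoint form) ⇒ BEC on the first sectors -/

/-- **MON-n ⇒ GM (endpoint form):** if the sector gap of `H(Δ)` is monotone in the particle number up to half filling for
every `Δ ∈ [Δ₀, 1]`, then `GapDominatesFerro Δ₀ k` for every `k` (eventually in `L`: `L ≥ max 3 (2k+2)`).  The three inputs:
one-magnon END (every `Δ`), particle–hole symmetry, and the sharpness `g ≤ 1 − cos(2π/L)` of any Temple-form gap bound at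
`Δ = 1` (`sectorGapAtLeast_one_le`).  [cite: CaputoLiggettRichthammer2010, Theorem 1.1] -/
theorem gapDominatesFerro_of_monotoneInN {Δ₀ : ℝ} (hmon : ∀ Δ : ℝ, Δ₀ ≤ Δ → Δ ≤ 1 → SectorGapMonotoneInN Δ) (k : ℕ) :
    GapDominatesFerro Δ₀ k := by
  unfold GapDominatesFerro
  filter_upwards [eventually_ge_atTop (max 3 (2 * k + 2))] with L hL
  intro _ j hj Δ g h0 h1 hG
  have hL3 : 3 ≤ L := le_trans (le_max_left _ _) hL
  have hLk : 2 * k + 2 ≤ L := le_trans (le_max_right _ _) hL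
  have hcard : Fintype.card (TorusSite 2 L) = L ^ 2 := by rw [Fintype.card_fun, ZMod.card, Fintype.card_fin]
  have hL2 : 2 * k + 2 ≤ L ^ 2 := le_trans hLk (by nlinarith)
  have hjk : (|j| : ℝ) ≤ k := by exact_mod_cast hj
  classical
  -- empty sector: vacuous
  by_cases hex : ∃ b : TensorIndex (TorusSite 2 L) 2 → ℝ, IsPerronSectorGroundAmplitude L Δ (j : ℝ) b
  swap
  · exact sectorGapAtLeast_of_no_perron (fun a ha => hex ⟨a, ha⟩)
  obtain ⟨b, hb⟩ := hex
  -- the particle number of the sector `j`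
  obtain ⟨n, hnV, hn⟩ := perron_natSector hb
  have habs := abs_le.mp (show |(j : ℝ)| ≤ k by exact_mod_cast hjk)
  have hcardR : (Fintype.card (TorusSite 2 L) : ℝ) = (L : ℝ) ^ 2 := by rw [hcard]; push_cast; ring
  have hL2R : 2 * (k : ℝ) + 2 ≤ (L : ℝ) ^ 2 := by exact_mod_cast hL2
  have hn1 : 1 ≤ n := by
    have : (1 : ℝ) ≤ n := by rw [hn, hcardR]; linarith [habs.1]
    exact_mod_cast this
  have hnlt : (Fintype.card (TorusSite 2 L) : ℝ) / 2 + j < Fintype.card (TorusSite 2 L) := by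
    rw [hcardR]; linarith [habs.2]
  -- Perron amplitude at `Δ = 1` in the same sector ⇒ `g ≤ ε₁`
  have hW : Fintype.card (TorusSite 2 L) - n ≤ L ^ 2 := by omega
  obtain ⟨b1, hb1⟩ := exists_perron_of_weight (L := L) 1 (Fintype.card (TorusSite 2 L) - n) hW
  have eW : ((Fintype.card (TorusSite 2 L) * 1 : ℕ) : ℝ) / 2 - ((Fintype.card (TorusSite 2 L) - n : ℕ) : ℝ) = (j : ℝ) := by
    rw [Nat.cast_sub hnV]; push_cast; linarith
  rw [eW] at hb1
  have hgε : g ≤ 1 - Real.cos (2 * Real.pi / (L : ℝ)) :=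
    sectorGapAtLeast_one_le hL3 hb1 (by rw [← hn]; exact_mod_cast hn1) hnlt hG
  refine sectorGapAtLeast_mono hgε ?_
  -- END at `(Δ, j)` from MON-n(Δ)
  have hmonΔ := hmon Δ h0 h1
  rcases le_or_gt j 0 with hj0 | hj0
  · exact end_int_of_monotoneInN hmonΔ hL3 h1 j hj0 n hn1 hn
  · -- `j > 0`: END at `−j` (sector of `V/2 − j = card − n` particles), then flip
    have hn' : ((Fintype.card (TorusSite 2 L) - n : ℕ) : ℝ) = (Fintype.card (TorusSite 2 L) : ℝ) / 2 + ((-j : ℤ) : ℝ) := by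
      rw [Nat.cast_sub hnV]; push_cast; linarith
    have hn1' : 1 ≤ Fintype.card (TorusSite 2 L) - n := by
      have : (1 : ℝ) ≤ ((Fintype.card (TorusSite 2 L) - n : ℕ) : ℝ) := by
        rw [hn', hcardR]; push_cast; linarith [habs.2]
      exact_mod_cast this
    have hneg := end_int_of_monotoneInN hmonΔ hL3 h1 (-j) (by omega) _ hn1' hn'
    have := sectorGapAtLeast_neg hneg
    push_cast at this
    rw [neg_neg] at this
    exact this

/-- **COROLLARY (BEC from MON-n):** `0 ≤ Δ < 1`, anchor `c₀`, CONJECTURE MON-n on `[Δ, 1]`, and the chain threshold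
`2(k+1)·Σ_{i≤k} D_i(1−Δ, c₀/4) < 2π²·c₀` ⇒ `CondensateOnFirstSectors Δ k`.  The only hypotheses left are the anchor and
MON-n. [cite: CaputoLiggettRichthammer2010, Theorem 1.1] -/
theorem condensateOnFirstSectors_of_monotoneInN {Δ c₀ : ℝ} {k : ℕ} (hΔ0 : 0 ≤ Δ) (hΔ1 : Δ < 1) (hc₀ : 0 < c₀)
    (hA : HalfFillingAnchor Δ c₀) (hmon : ∀ Δ' : ℝ, Δ ≤ Δ' → Δ' ≤ 1 → SectorGapMonotoneInN Δ')
    (hsmall : 2 * ((k : ℝ) + 1) * (∑ i ∈ Finset.range (k + 1), dSeq (1 - Δ) (c₀ / 4) i) < 2 * Real.pi ^ 2 * c₀) :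
    CondensateOnFirstSectors Δ k :=
  condensateOnFirstSectors_of_gapDominatesFerro' le_rfl hΔ0 hΔ1 hc₀ hA
    (gapDominatesFerro_of_monotoneInN hmon (k + 1)) hsmall

end Summit.HubbardSuperconductivity.HubbardSuperconductivity.Theorems.AnisotropyChord.Transfer

end
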